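import Summits.Ventures.PercRepro.C041CutSplitReach

/-!
# A cut vertex of a loose zone port problem: the Good bits decompose (p6, gen 25; C-041.md §9)

For a split `sp` of `L` at `u`: the terminal edges split into those of the gadget side (`Term₁`: zone inside `S₁`)
and those of the far side (`Term₂`); a pattern restricts to both sides (`res₁`, `res₂`); the deleted sets restrict
(`A₁'`, `A₂'` on the gadget side, `A₁''`, `A₂''` on the far side — `mem_A₁_iff_S₁` …: on `S₁` the deleted set of
the whole pattern is that of the gadget pattern, on `S₂` that of the far pattern); the bits of §9 are
* the gadget's own Good bits `G₁'`, `G₂'` (endpoints of the gadget side reached from the root set inside `S₁`),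
* the reach bits `ρ₁`, `ρ₂` (`u` reached from the root set inside `S₁` avoiding the gadget's deleted zones),
* the far side's Good bits `G₁''`, `G₂''` (endpoints of the far side reached from `u` inside `S₂`),
and THE DECOMPOSITION `good₁_iff` / `good₂_iff`: `Good_t(x) ⟺ G_t'(x₁) ∨ (ρ_t(x₁) ∧ G_t''(x₂))` — the paper's
«on side `t` the endpoints of `Γ″` are reachable iff `ρ_t^σ ∧ G_t″(x′)`, those of `𝒫` iff `G_t^σ`», by the
path-splitting lemma.
-/

namespace PercRepro

namespace ZonePort

namespace Loose

namespace Split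

variable {V E : Type*} {L : Loose V E} (sp : L.Split)

/-- A terminal edge of the gadget side: its zone lies inside `S₁`. -/
def InS₁ (e : L.Term) : Prop := ∀ v ∈ L.tz e.1, v ∈ sp.S₁

/-- The terminal edges of the gadget side. -/
abbrev Term₁ : Type _ := {e : L.Term // sp.InS₁ e}

/-- The terminal edges of the far side. -/
abbrev Term₂ : Type _ := {e : L.Term // ¬ sp.InS₁ e}

/-- The zone of a far-side edge lies inside `S₂`. -/
theorem zone_subset_S₂_of_not_inS₁ {e : L.Term} (he : ¬ sp.InS₁ e) : ∀ v ∈ L.tz e.1, v ∈ sp.S₂ := by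
  rcases sp.hzone _ e.2 with h | h
  · exact absurd h he
  · exact h

/-- The vertex of a gadget-side edge lies in `S₁`. -/
theorem tv_mem_S₁ (e : sp.Term₁) : L.tv e.1.1 ∈ sp.S₁ := e.2 _ (L.htv _)

/-- The vertex of a far-side edge lies in `S₂`. -/
theorem tv_mem_S₂ (e : sp.Term₂) : L.tv e.1.1 ∈ sp.S₂ :=
  sp.zone_subset_S₂_of_not_inS₁ e.2 _ (L.htv _)

/-- An edge whose zone contains a vertex of `S₁` is a gadget-side edge. -/
theorem inS₁_of_mem {e : L.Term} {v : V} (hv : v ∈ L.tz e.1) (hv₁ : v ∈ sp.S₁) : sp.InS₁ e :=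
  sp.zone_subset_S₁ e.2 hv hv₁

/-- An edge whose zone contains a vertex of `S₂` is a far-side edge. -/
theorem not_inS₁_of_mem {e : L.Term} {v : V} (hv : v ∈ L.tz e.1) (hv₂ : v ∈ sp.S₂) : ¬ sp.InS₁ e := by
  intro h
  have := sp.hmeet v (h v hv) hv₂
  subst this
  exact sp.hu ⟨_, e.2, hv⟩

/-- The restriction of a pattern to the gadget side. -/
def res₁ (x : L.Term → Bool) : sp.Term₁ → Bool := fun e => x e.1

/-- The restriction of a pattern to the far side. -/
def res₂ (x : L.Term → Bool) : sp.Term₂ → Bool := fun e => x e.1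

/-- The gadget side's deleted set on side `1`. -/
def A₁' (x₁ : sp.Term₁ → Bool) : Set V :=
  {v | ∃ e : sp.Term₁, L.ts e.1.1 = false ∧ x₁ e = false ∧ v ∈ L.tz e.1.1}

/-- The gadget side's deleted set on side `2`. -/
def A₂' (x₁ : sp.Term₁ → Bool) : Set V :=
  {v | ∃ e : sp.Term₁, L.ts e.1.1 = true ∧ x₁ e = false ∧ v ∈ L.tz e.1.1}

/-- The far side's deleted set on side `1`. -/
def A₁'' (x₂ : sp.Term₂ → Bool) : Set V :=
  {v | ∃ e : sp.Term₂, L.ts e.1.1 = false ∧ x₂ e = false ∧ v ∈ L.tz e.1.1}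

/-- The far side's deleted set on side `2`. -/
def A₂'' (x₂ : sp.Term₂ → Bool) : Set V :=
  {v | ∃ e : sp.Term₂, L.ts e.1.1 = true ∧ x₂ e = false ∧ v ∈ L.tz e.1.1}

/-- On `S₁`, the deleted set on side `1` is the gadget's. -/
theorem mem_A₁_iff_S₁ (x : L.Term → Bool) {v : V} (hv : v ∈ sp.S₁) :
    v ∈ L.A₁ x ↔ v ∈ sp.A₁' (sp.res₁ x) := by
  constructor
  · rintro ⟨e, hts, hxe, hve⟩
    exact ⟨⟨e, sp.inS₁_of_mem hve hv⟩, hts, hxe, hve⟩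
  · rintro ⟨e, hts, hxe, hve⟩
    exact ⟨e.1, hts, hxe, hve⟩

/-- On `S₁`, the deleted set on side `2` is the gadget's. -/
theorem mem_A₂_iff_S₁ (x : L.Term → Bool) {v : V} (hv : v ∈ sp.S₁) :
    v ∈ L.A₂ x ↔ v ∈ sp.A₂' (sp.res₁ x) := by
  constructor
  · rintro ⟨e, hts, hxe, hve⟩
    exact ⟨⟨e, sp.inS₁_of_mem hve hv⟩, hts, hxe, hve⟩
  · rintro ⟨e, hts, hxe, hve⟩
    exact ⟨e.1, hts, hxe, hve⟩

/-- On `S₂`, the deleted set on side `1` is the far side's. -/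
theorem mem_A₁_iff_S₂ (x : L.Term → Bool) {v : V} (hv : v ∈ sp.S₂) :
    v ∈ L.A₁ x ↔ v ∈ sp.A₁'' (sp.res₂ x) := by
  constructor
  · rintro ⟨e, hts, hxe, hve⟩
    exact ⟨⟨e, sp.not_inS₁_of_mem hve hv⟩, hts, hxe, hve⟩
  · rintro ⟨e, hts, hxe, hve⟩
    exact ⟨e.1, hts, hxe, hve⟩

/-- On `S₂`, the deleted set on side `2` is the far side's. -/
theorem mem_A₂_iff_S₂ (x : L.Term → Bool) {v : V} (hv : v ∈ sp.S₂) :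
    v ∈ L.A₂ x ↔ v ∈ sp.A₂'' (sp.res₂ x) := by
  constructor
  · rintro ⟨e, hts, hxe, hve⟩
    exact ⟨⟨e, sp.not_inS₁_of_mem hve hv⟩, hts, hxe, hve⟩
  · rintro ⟨e, hts, hxe, hve⟩
    exact ⟨e.1, hts, hxe, hve⟩

/-- `G₁'`: the gadget's own `Good₁` — a red 2-edge of the gadget side carried by a vertex reached from the root set
inside `S₁` avoiding the gadget's side-`1` deletions. -/
def G₁' (x₁ : sp.Term₁ → Bool) : Prop :=
  ∃ e : sp.Term₁, L.ts e.1.1 = true ∧ x₁ e = true ∧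
    ∃ r ∈ L.root, L.SReach sp.S₁ (sp.A₁' x₁) r (L.tv e.1.1)

/-- `G₂'`: the gadget's own `Good₂`. -/
def G₂' (x₁ : sp.Term₁ → Bool) : Prop :=
  ∃ e : sp.Term₁, L.ts e.1.1 = false ∧ x₁ e = true ∧
    ∃ r ∈ L.root, L.SReach sp.S₁ (sp.A₂' x₁) r (L.tv e.1.1)

/-- `ρ₁`: the cut vertex is reached from the root set inside `S₁` avoiding the gadget's side-`1` deletions. -/
def ρ₁ (x₁ : sp.Term₁ → Bool) : Prop := ∃ r ∈ L.root, L.SReach sp.S₁ (sp.A₁' x₁) r sp.u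

/-- `ρ₂`: the cut vertex is reached from the root set inside `S₁` avoiding the gadget's side-`2` deletions. -/
def ρ₂ (x₁ : sp.Term₁ → Bool) : Prop := ∃ r ∈ L.root, L.SReach sp.S₁ (sp.A₂' x₁) r sp.u

/-- `G₁''`: the far side's `Good₁` from the root `u` — a red 2-edge of the far side carried by a vertex reached from
`u` inside `S₂` avoiding the far side's side-`1` deletions. -/
def G₁'' (x₂ : sp.Term₂ → Bool) : Prop :=
  ∃ e : sp.Term₂, L.ts e.1.1 = true ∧ x₂ e = true ∧ L.SReach sp.S₂ (sp.A₁'' x₂) sp.u (L.tv e.1.1)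

/-- `G₂''`: the far side's `Good₂` from the root `u`. -/
def G₂'' (x₂ : sp.Term₂ → Bool) : Prop :=
  ∃ e : sp.Term₂, L.ts e.1.1 = false ∧ x₂ e = true ∧ L.SReach sp.S₂ (sp.A₂'' x₂) sp.u (L.tv e.1.1)

/-- **`Good₁` decomposes at the cut vertex**: `Good₁(x) ⟺ G₁'(x₁) ∨ (ρ₁(x₁) ∧ G₁''(x₂))`. -/
theorem good₁_iff (x : L.Term → Bool) :
    L.Good₁ x ↔ sp.G₁' (sp.res₁ x) ∨ (sp.ρ₁ (sp.res₁ x) ∧ sp.G₁'' (sp.res₂ x)) := by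
  have hA := L.A₁_subset x
  have h₁ : ∀ r ∈ L.root, ∀ v, L.SReach sp.S₁ (L.A₁ x) r v ↔ L.SReach sp.S₁ (sp.A₁' (sp.res₁ x)) r v :=
    fun r hr v => sreach_congr (fun w hw => sp.mem_A₁_iff_S₁ x hw) (sp.hroot r hr)
  have h₂ : ∀ v, L.SReach sp.S₂ (L.A₁ x) sp.u v ↔ L.SReach sp.S₂ (sp.A₁'' (sp.res₂ x)) sp.u v :=
    fun v => sreach_congr (fun w hw => sp.mem_A₁_iff_S₂ x hw) sp.hu₂
  constructor
  · rintro ⟨e, hts, hxe, hR⟩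
    by_cases he : sp.InS₁ e
    · left
      obtain ⟨r, hr, hrv⟩ := (sp.rreach_iff_of_mem_S₁ hA (he _ (L.htv _))).1 hR
      exact ⟨⟨e, he⟩, hts, hxe, r, hr, (h₁ r hr _).1 hrv⟩
    · right
      obtain ⟨⟨r, hr, hru⟩, huv⟩ :=
        (sp.rreach_iff_of_mem_S₂ hA (sp.zone_subset_S₂_of_not_inS₁ he _ (L.htv _))).1 hR
      exact ⟨⟨r, hr, (h₁ r hr _).1 hru⟩, ⟨e, he⟩, hts, hxe, (h₂ _).1 huv⟩
  · rintro (⟨e, hts, hxe, r, hr, hrv⟩ | ⟨⟨r, hr, hru⟩, e, hts, hxe, huv⟩)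
    · exact ⟨e.1, hts, hxe, (sp.rreach_iff_of_mem_S₁ hA (sp.tv_mem_S₁ e)).2 ⟨r, hr, (h₁ r hr _).2 hrv⟩⟩
    · exact ⟨e.1, hts, hxe, (sp.rreach_iff_of_mem_S₂ hA (sp.tv_mem_S₂ e)).2
        ⟨⟨r, hr, (h₁ r hr _).2 hru⟩, (h₂ _).2 huv⟩⟩

/-- **`Good₂` decomposes at the cut vertex**: `Good₂(x) ⟺ G₂'(x₁) ∨ (ρ₂(x₁) ∧ G₂''(x₂))`. -/
theorem good₂_iff (x : L.Term → Bool) :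
    L.Good₂ x ↔ sp.G₂' (sp.res₁ x) ∨ (sp.ρ₂ (sp.res₁ x) ∧ sp.G₂'' (sp.res₂ x)) := by
  have hA := L.A₂_subset x
  have h₁ : ∀ r ∈ L.root, ∀ v, L.SReach sp.S₁ (L.A₂ x) r v ↔ L.SReach sp.S₁ (sp.A₂' (sp.res₁ x)) r v :=
    fun r hr v => sreach_congr (fun w hw => sp.mem_A₂_iff_S₁ x hw) (sp.hroot r hr)
  have h₂ : ∀ v, L.SReach sp.S₂ (L.A₂ x) sp.u v ↔ L.SReach sp.S₂ (sp.A₂'' (sp.res₂ x)) sp.u v :=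
    fun v => sreach_congr (fun w hw => sp.mem_A₂_iff_S₂ x hw) sp.hu₂
  constructor
  · rintro ⟨e, hts, hxe, hR⟩
    by_cases he : sp.InS₁ e
    · left
      obtain ⟨r, hr, hrv⟩ := (sp.rreach_iff_of_mem_S₁ hA (he _ (L.htv _))).1 hR
      exact ⟨⟨e, he⟩, hts, hxe, r, hr, (h₁ r hr _).1 hrv⟩
    · right
      obtain ⟨⟨r, hr, hru⟩, huv⟩ :=
        (sp.rreach_iff_of_mem_S₂ hA (sp.zone_subset_S₂_of_not_inS₁ he _ (L.htv _))).1 hR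
      exact ⟨⟨r, hr, (h₁ r hr _).1 hru⟩, ⟨e, he⟩, hts, hxe, (h₂ _).1 huv⟩
  · rintro (⟨e, hts, hxe, r, hr, hrv⟩ | ⟨⟨r, hr, hru⟩, e, hts, hxe, huv⟩)
    · exact ⟨e.1, hts, hxe, (sp.rreach_iff_of_mem_S₁ hA (sp.tv_mem_S₁ e)).2 ⟨r, hr, (h₁ r hr _).2 hrv⟩⟩
    · exact ⟨e.1, hts, hxe, (sp.rreach_iff_of_mem_S₂ hA (sp.tv_mem_S₂ e)).2
        ⟨⟨r, hr, (h₁ r hr _).2 hru⟩, (h₂ _).2 huv⟩⟩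

end Split

end Loose

end ZonePort

end PercRepro
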